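import Literature.NumberTheory.GaloisRepresentations.LubinTateColemanTraceLevel
import Literature.NumberTheory.GaloisRepresentations.LubinTateColemanNormEquivariant
import HarnessLib

/-!
# Coleman's trace operator commutes with the `𝒪_Fˣ`-action `h ↦ h ∘ [v]_f`

De Shalit, *Iwasawa theory of elliptic curves with complex multiplication* (1987), Ch. I §3.12–3.14: the
trace operator `𝒮` (`(𝒮h) ∘ f = Σ_{ω ∈ W_f^1} h(X [+] ω)`, tree `colemanTrace`) is, like the norm
operator `𝒩` (`colemanNorm_subst_hom`, `LubinTateColemanNormEquivariant.lean`), EQUIVARIANT for the action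
of `𝒪_Fˣ` (the Galois group, through the Lubin–Tate character) on `𝒪_F⟦X⟧` by `h ↦ h ∘ [v]_f`; this is what
makes `β ↦ μ_β` a homomorphism of `Λ(𝒢)`-modules (I §3.4 Lemma (ii), Cor.). Everything **proved**
(`f = πX + X^q` over any non-archimedean local field `F`):

* `evalAt_colemanTrace_subst_hom` — `(𝒮(h ∘ [v]))([π] x) = ((𝒮h) ∘ [v])([π] x)` at every point
  (both are `Σ_c h([v]x [+] ω_c)` after `[v]` permutes `W_f^1`).
* ★ `colemanTrace_subst_hom` — **`𝒮(h ∘ [v]_f) = (𝒮h) ∘ [v]_f`** for `v ∈ 𝒪_Fˣ` (agreement at the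
  generators `ω_{m+1} = [π] ω_{m+2}` of all levels + the zeros lemma).

## References

* E. de Shalit, *Iwasawa theory of elliptic curves with complex multiplication* (1987), Ch. I §3.4
  Lemma (ii), §3.12. [cite: deShalit1987, Ch. I §3.4]

## Mathlib reuse

`Fintype.sum_equiv`; from the tree: `LubinTateColemanTrace.lean` (`colemanTrace`, `evalAt_ltSMul_colemanTrace`),
`LubinTateColemanTraceLevel.lean` (`colemanTrace_level_eq`), `LubinTateColemanNormEquivariant.lean`
(`exists_perm_ltAct_ltDivPt`), `LubinTateColemanLevel.lean` (`evalAt_subst_hom`), `LubinTateColemanZeros.lean`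
(`eq_of_frequently_evalAt_ltSMul_genPt_eq`), `LubinTateTowerGenerator.lean` (`cohPt`, `ltAct_pi_cohPt_succ`,
`inclUnitBall_evalAt`).
-/

noncomputable section

open Filter Topology Polynomial ValuativeRel
open scoped PowerSeries.WithPiTopology

namespace Literature.NumberTheory.GaloisRepresentations

section LocalFieldTE

open GaloisRepresentations.IsNonarchimedeanLocalField LubinTate

variable (F : Type*) [Field F] [ValuativeRel F] [TopologicalSpace F] [IsNonarchimedeanLocalField F]

attribute [local instance] ltNormUniformSpace ltNormIsUniformAddGroup rk1 nF nE fintypeResidueField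

variable {F}
variable {π : 𝒪[F]} (hπ : (valuation F).IsUniformizer (π : F)) (n : ℕ)

/-- **`(𝒮(h ∘ [v]))([π] x) = ((𝒮h) ∘ [v])([π] x)`** at every point `x ∈ 𝔪_{K_π^{n+1}}` (`v` a unit): both
are `Σ_c h([v]x [+] ω_c)` after re-indexing `W_f^1` by `[v]`. [cite: deShalit1987, Ch. I §3.4] -/
theorem evalAt_colemanTrace_subst_hom (v : 𝒪[F]ˣ) (h : PowerSeries (LTCoeff F))
    (x : (maxNilIdeal F (ltField π n)).toIdeal) :
    evalAt (maxNilIdeal F (ltField π n)) (ltAct hπ n π x)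
        (colemanTrace hπ n (PowerSeries.subst
          (hom (isLTRing_LTCoeff hπ) (isLTSeries_LTCoeff π) (isLTSeries_LTCoeff π) (LTCoeff.of F (v : 𝒪[F]))) h)) =
      evalAt (maxNilIdeal F (ltField π n)) (ltAct hπ n π x)
        (PowerSeries.subst
          (hom (isLTRing_LTCoeff hπ) (isLTSeries_LTCoeff π) (isLTSeries_LTCoeff π) (LTCoeff.of F (v : 𝒪[F])))
          (colemanTrace hπ n h)) := by
  rw [ltAct, evalAt_ltSMul_colemanTrace, evalAt_subst_hom hπ]
  have hcomm : ltSMul (maxNilIdeal F (ltField π n)) (isLTRing_LTCoeff hπ) (isLTSeries_LTCoeff π)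
      (LTCoeff.of F (v : 𝒪[F])) (ltSMul (maxNilIdeal F (ltField π n)) (isLTRing_LTCoeff hπ)
        (isLTSeries_LTCoeff π) (LTCoeff.of F π) x) =
      ltSMul (maxNilIdeal F (ltField π n)) (isLTRing_LTCoeff hπ) (isLTSeries_LTCoeff π) (LTCoeff.of F π)
        (ltSMul (maxNilIdeal F (ltField π n)) (isLTRing_LTCoeff hπ) (isLTSeries_LTCoeff π)
          (LTCoeff.of F (v : 𝒪[F])) x) := by
    rw [← mul_ltSMul, ← mul_ltSMul, mul_comm]
  rw [hcomm, evalAt_ltSMul_colemanTrace]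
  obtain ⟨τ, hτ⟩ := exists_perm_ltAct_ltDivPt hπ n v
  simp_rw [evalAt_subst_hom hπ, ltSMul_ltAdd]
  have e : ∀ c, ltSMul (maxNilIdeal F (ltField π n)) (isLTRing_LTCoeff hπ) (isLTSeries_LTCoeff π)
      (LTCoeff.of F (v : 𝒪[F])) (ltDivPt hπ n c) = ltDivPt hπ n (τ c) := hτ
  simp_rw [e]
  exact Fintype.sum_equiv τ _ _ (fun c => rfl)

/-- The inclusion `𝒪_{E₁} → 𝒪_{E₂}` is injective (generic intermediate fields).
[cite: deShalit1987, Ch. I §1.8] -/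
private theorem inclUnitBall_injective'' {E₁ E₂ : IntermediateField F (AlgebraicClosure F)}
    [FiniteDimensional F E₁] [FiniteDimensional F E₂] (hle : E₁ ≤ E₂) :
    Function.Injective (inclUnitBall (F := F) hle) := by
  intro a b hab
  have h1 := congrArg (fun z : unitBall E₂ => ((z : E₂) : AlgebraicClosure F)) hab
  exact Subtype.ext (Subtype.ext h1)

/-- The values of `𝒮(h ∘ [v])` and `(𝒮h) ∘ [v]` agree at `ω_{m+1}` as soon as `ω_{m+1} = [π] y` in a higher
level (generic levels). [cite: deShalit1987, Ch. I §3.4] -/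
theorem evalAt_cohPt_colemanTrace_subst_hom_of_eq (v : 𝒪[F]ˣ) (h : PowerSeries (LTCoeff F)) {m m' : ℕ}
    (hle : ltField π m ≤ ltField π m') (y : (maxNilIdeal F (ltField π m')).toIdeal)
    (hy : inclPt hle (cohPt hπ m) = ltAct hπ m' π y) :
    evalAt (maxNilIdeal F (ltField π m)) (cohPt hπ m)
        (colemanTrace hπ n (PowerSeries.subst
          (hom (isLTRing_LTCoeff hπ) (isLTSeries_LTCoeff π) (isLTSeries_LTCoeff π) (LTCoeff.of F (v : 𝒪[F]))) h)) =
      evalAt (maxNilIdeal F (ltField π m)) (cohPt hπ m)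
        (PowerSeries.subst
          (hom (isLTRing_LTCoeff hπ) (isLTSeries_LTCoeff π) (isLTSeries_LTCoeff π) (LTCoeff.of F (v : 𝒪[F])))
          (colemanTrace hπ n h)) := by
  apply inclUnitBall_injective'' hle
  rw [inclUnitBall_evalAt, inclUnitBall_evalAt, hy, colemanTrace_level_eq hπ n m', colemanTrace_level_eq hπ n m']
  exact evalAt_colemanTrace_subst_hom hπ m' v h y

/-- ★ **`𝒮(h ∘ [v]_f) = (𝒮h) ∘ [v]_f`** for a unit `v ∈ 𝒪_Fˣ`: Coleman's trace operator commutes with the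
`𝒪_Fˣ`-action (both sides agree at `ω_{m+1} = [π] ω_{m+2}` for every `m`; zeros lemma).
[cite: deShalit1987, Ch. I §3.4] -/
theorem colemanTrace_subst_hom (v : 𝒪[F]ˣ) (h : PowerSeries (LTCoeff F)) :
    colemanTrace hπ n (PowerSeries.subst
        (hom (isLTRing_LTCoeff hπ) (isLTSeries_LTCoeff π) (isLTSeries_LTCoeff π) (LTCoeff.of F (v : 𝒪[F]))) h) =
      PowerSeries.subst
        (hom (isLTRing_LTCoeff hπ) (isLTSeries_LTCoeff π) (isLTSeries_LTCoeff π) (LTCoeff.of F (v : 𝒪[F])))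
        (colemanTrace hπ n h) := by
  refine eq_of_frequently_evalAt_ltSMul_genPt_eq hπ (fun m => (cohUnit hπ m : 𝒪[F]))
    (fun m => (cohUnit hπ m).isUnit) (Filter.Frequently.of_forall fun m => ?_)
  exact evalAt_cohPt_colemanTrace_subst_hom_of_eq hπ n v h (ltField_le_succ hπ m) (cohPt hπ (m + 1))
    (ltAct_pi_cohPt_succ hπ m).symm

end LocalFieldTE

end Literature.NumberTheory.GaloisRepresentations
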